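import Summits.QuantumFields.QCD.Theorems.QuarksAsStableActionCriticalLineDiamagnetismStubHeavyFrequencyGainAux

/-!
# S4 `stub_heavyFrequencyGain` — Wilson quarks GAIN at the heavy frequencies (crux `stmt-QuantumFields-9734`, line `Sketch`)

Sub-problem context: `Summits/QuantumFields/QCD/Statement.lean`; crux decl
`Summit.QuantumFields.QCD.Theses.QuarksAsStableAction.CriticalLineDiamagnetism`; this file closes the registered stub
`stub_heavyFrequencyGain` of the line skeleton (`Cruxes/CriticalLineDiamagnetism/Lines/Sketch.lean`, static route S4).

ROUTE B (reflection positivity in frequency land): per heavy frequency on the odd torus `(ℤ/L)²`, `L = 2n+1`: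
rows — `reflectionChain` + `staticPressureOdd` (averaged over the reflection row); columns of every slab pattern — transpose +
`reflectionChain` + `staticPressureEven`; cells — `cellGaugeFix` + `cellLemma` (B6, with the certified `CellKappaClaim`); free
side — `freeGap` twice with the free `(2n)×L` determinant as pivot; double averaging.  Pure theorem file.  References: Lüscher,
Commun. Math. Phys. 54 (1977) 283; Osterwalder–Seiler, Ann. Phys. 110 (1978) 440; Fröhlich–Israel–Lieb–Simon, Commun. Math. Phys.
62 (1978) 1; Salmhofer–Seiler, Commun. Math. Phys. 139 (1991) 395.  Plan: lead folder `work/odd/S4-PLAN.md`.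
-/
noncomputable section
open scoped BigOperators Matrix ComplexOrder
open Matrix Literature.MathematicalPhysics.QuantumLattice
open Summit.QuantumFields.QCD.Cruxes.CriticalLineDiamagnetism.ChessboardCellGain.FrequencyDiamagnetism
open Summit.QuantumFields.QCD.Cruxes.CriticalLineDiamagnetism.ChessboardCellGain.CellKappa

namespace Summit.QuantumFields.QCD.Cruxes.CriticalLineDiamagnetism.ChessboardCellGain
namespace HeavyGain

/-- **Core of S4** (log form, lattice `ℤ/(2n+1)²`, modulo `CellKappaClaim`). -/
theorem heavyGain_core (hK : CellKappaClaim) : ∃ δ c C : ℝ, 0 < δ ∧ 0 < c ∧ 0 ≤ C ∧ ∀ (n : ℕ) [NeZero n], 12 ≤ n →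
    ∀ (A : ZMod (2 * n + 1) → ZMod (2 * n + 1) → Fin 4 → Matrix.unitaryGroup (Fin 3) ℂ) (m : ℝ), |m| ≤ 1 / 10 →
    ∀ ω₀ ω₁ : ℝ, Real.cos ω₀ ≤ -(199 / 200) → Real.cos ω₁ ≤ -(199 / 200) →
    (freqOpR euclideanGamma A m ω₀ ω₁).det ≠ 0 →
    (freqOpR euclideanGamma (fun (_ _ : ZMod (2 * n + 1)) (_ : Fin 4) => (1 : Matrix.unitaryGroup (Fin 3) ℂ)) m ω₀ ω₁).det ≠ 0 ∧
    Real.log ‖(freqOpR euclideanGamma A m ω₀ ω₁).det‖ ≤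
      Real.log ‖(freqOpR euclideanGamma (fun (_ _ : ZMod (2 * n + 1)) (_ : Fin 4) => (1 : Matrix.unitaryGroup (Fin 3) ℂ)) m ω₀ ω₁).det‖ +
      (1 / ((2 * n + 1 : ℕ) : ℝ) ^ 2
        - c * (∑ ab ∈ (Finset.univ : Finset (ZMod (2 * n + 1) × ZMod (2 * n + 1))).filter (fun ab =>
            3 - (((A ab.1 ab.2 2 * A (ab.1 + 1) ab.2 3 * (A ab.1 (ab.2 + 1) 2)⁻¹ * (A ab.1 ab.2 3)⁻¹ :
              Matrix.unitaryGroup (Fin 3) ℂ) : Matrix (Fin 3) (Fin 3) ℂ).trace).re < δ),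
            (3 - (((A ab.1 ab.2 2 * A (ab.1 + 1) ab.2 3 * (A ab.1 (ab.2 + 1) 2)⁻¹ * (A ab.1 ab.2 3)⁻¹ :
              Matrix.unitaryGroup (Fin 3) ℂ) : Matrix (Fin 3) (Fin 3) ℂ).trace).re))
        + C * ((((Finset.univ : Finset (ZMod (2 * n + 1) × ZMod (2 * n + 1))).filter (fun ab =>
            δ ≤ 3 - (((A ab.1 ab.2 2 * A (ab.1 + 1) ab.2 3 * (A ab.1 (ab.2 + 1) 2)⁻¹ * (A ab.1 ab.2 3)⁻¹ :
              Matrix.unitaryGroup (Fin 3) ℂ) : Matrix (Fin 3) (Fin 3) ℂ).trace).re)).card : ℕ) : ℝ)) := by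
  obtain ⟨δ₀, c₀, C₀, hδ₀, hc₀, hcellAll⟩ := cellLemma hK
  refine ⟨δ₀, c₀ / 5, max C₀ 0, hδ₀, by positivity, le_max_right _ _, ?_⟩
  intro n _ hn A m hm ω₀ ω₁ h0 h1 hA0
  have hm1 : -1 < m := by have := (abs_le.mp hm).1; linarith
  have hL := (rectTransferForm 1 (2 * n + 1) (fun _ _ _ => 1) m hm1 ω₀ ω₁).2 0
  have h2n := (rectTransferForm 1 (2 * n) (fun _ _ _ => 1) m hm1 ω₀ ω₁).2 0
  have hcell := hcellAll n hn m hm ω₀ ω₁ h0 h1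
  have hfree := freeSide n hm h0 h1 hL h2n
  have hslack := slack_le n (le_trans (by norm_num) hn)
  obtain ⟨_, _, hFLeq⟩ := log_norm_det_free (2 * n + 1) (2 * n + 1) hm h0 h1 hL
  have hFLne : (freqOpR euclideanGamma (fun (_ _ : ZMod (2 * n + 1)) (_ : Fin 4) =>
      (1 : Matrix.unitaryGroup (Fin 3) ℂ)) m ω₀ ω₁).det ≠ 0 :=
    (heavyInvertible (2 * n + 1) (2 * n + 1) _ m hm ω₀ ω₁ h0 h1).ne_zero
  refine ⟨hFLne, ?_⟩
  -- chain 1 (rows)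
  have hA0' : (tfreqOpR A m ω₀ ω₁).det ≠ 0 := by rwa [det_tfreqOpR]
  have c1 := chain1 n A hm ω₀ ω₁ hL hA0'
  rw [det_tfreqOpR] at c1
  -- chain 2 (columns) + cells, for every row pattern
  have h23 : (Equiv.swap (2 : Fin 4) 3) 3 = 2 := Equiv.swap_apply_right _ _
  have h22 : (Equiv.swap (2 : Fin 4) 3) 2 = 3 := Equiv.swap_apply_left _ _
  have c23 : ∀ s : ZMod (2 * n + 1),
      Real.log ‖(tfreqOpR (fun (σ : ZMod (2 * n)) (x : ZMod (2 * n + 1)) (μ : Fin 4) =>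
        if μ = 3 then (if σ.val % 2 = 0 then A s x 3 else A (s + 1) x 3)
        else if μ = 2 then (if σ.val % 2 = 0 then A s x 2 else (A s x 2)⁻¹) else 1) m ω₀ ω₁).det‖ ≤
      (Real.log ‖(sliceOpR (fun (_ : ZMod 1) (_ : ZMod (2 * n)) (_ : Fin 4) => (1 : Matrix.unitaryGroup (Fin 3) ℂ)) m ω₀ ω₁ 0 *
          projM (2 * n) - projP (2 * n)).det‖ + ∑ i, Real.log (max (h2n.1.eigenvalues i) 1)) +
      (1 / (2 * n + 1 : ℝ)) * ∑ x : ZMod (2 * n + 1),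
        (Real.log ‖(freqOpR euclideanGamma (fun (_ _ : ZMod (2 * n)) (_ : Fin 4) => (1 : Matrix.unitaryGroup (Fin 3) ℂ)) m ω₀ ω₁).det‖ +
          (n : ℝ) ^ 2 * (if 3 - (((A s x 2 * A (s + 1) x 3 * (A s (x + 1) 2)⁻¹ * (A s x 3)⁻¹ : Matrix.unitaryGroup (Fin 3) ℂ) :
              Matrix (Fin 3) (Fin 3) ℂ).trace).re < δ₀ then
            -c₀ * (3 - (((A s x 2 * A (s + 1) x 3 * (A s (x + 1) 2)⁻¹ * (A s x 3)⁻¹ : Matrix.unitaryGroup (Fin 3) ℂ) :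
              Matrix (Fin 3) (Fin 3) ℂ).trace).re) else C₀)) := by
    intro s
    rw [norm_det_tfreqOpR_transpose]
    refine (chain2 n _ hm ω₀ ω₁ h2n (by
      rw [det_tfreqOpR]; exact (heavyInvertible (2 * n + 1) (2 * n) _ m hm ω₀ ω₁ h0 h1).ne_zero)).trans ?_
    gcongr with x
    exact cellStep n A m ω₀ ω₁ _ δ₀ c₀ C₀ hcell s x
      (fun (b : ZMod (2 * n + 1)) (a : ZMod (2 * n)) (ν : Fin 4) =>
        (fun (σ : ZMod (2 * n)) (x' : ZMod (2 * n + 1)) (μ : Fin 4) =>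
          if μ = 3 then (if σ.val % 2 = 0 then A s x' 3 else A (s + 1) x' 3)
          else if μ = 2 then (if σ.val % 2 = 0 then A s x' 2 else (A s x' 2)⁻¹) else 1) a b (Equiv.swap (2 : Fin 4) 3 ν))
      (fun y => by simp only [h23]; exact if_neg (by decide))
      (fun y => by simp only [h23]; exact if_neg (by decide))
      (fun y => by simp only [h22, if_true])
  -- combine the two chains
  have hLpos : (0 : ℝ) < 2 * n + 1 := by positivity
  have hsum := Finset.sum_le_sum fun s (_ : s ∈ (Finset.univ : Finset (ZMod (2 * n + 1)))) => c23 s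
  have hmain := c1.trans (add_le_add (le_refl _) (mul_le_mul_of_nonneg_left hsum (by positivity : (0 : ℝ) ≤ 1 / (2 * n + 1 : ℝ))))
  have hcardT : (Fintype.card (ZMod (2 * n + 1)) : ℝ) = 2 * n + 1 := by rw [ZMod.card]; push_cast; ring
  have havg := double_avg (T := ZMod (2 * n + 1))
    (Real.log ‖(sliceOpR (fun (_ : ZMod 1) (_ : ZMod (2 * n)) (_ : Fin 4) => (1 : Matrix.unitaryGroup (Fin 3) ℂ)) m ω₀ ω₁ 0 *
          projM (2 * n) - projP (2 * n)).det‖ + ∑ i, Real.log (max (h2n.1.eigenvalues i) 1))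
    (Real.log ‖(freqOpR euclideanGamma (fun (_ _ : ZMod (2 * n)) (_ : Fin 4) => (1 : Matrix.unitaryGroup (Fin 3) ℂ)) m ω₀ ω₁).det‖)
    ((n : ℝ) ^ 2)
    (fun s x => if 3 - (((A s x 2 * A (s + 1) x 3 * (A s (x + 1) 2)⁻¹ * (A s x 3)⁻¹ : Matrix.unitaryGroup (Fin 3) ℂ) :
              Matrix (Fin 3) (Fin 3) ℂ).trace).re < δ₀ then
            -c₀ * (3 - (((A s x 2 * A (s + 1) x 3 * (A s (x + 1) 2)⁻¹ * (A s x 3)⁻¹ : Matrix.unitaryGroup (Fin 3) ℂ) :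
              Matrix (Fin 3) (Fin 3) ℂ).trace).re) else C₀)
    Fintype.card_pos
  rw [hcardT] at havg
  rw [havg] at hmain
  -- the double sum over plaquettes, split into good and bad
  rw [← Fintype.sum_prod_type'] at hmain
  rw [sum_ite_split] at hmain
  -- conclude by real arithmetic
  have hS0 : 0 ≤ ∑ ab ∈ (Finset.univ : Finset (ZMod (2 * n + 1) × ZMod (2 * n + 1))).filter (fun ab =>
            3 - (((A ab.1 ab.2 2 * A (ab.1 + 1) ab.2 3 * (A ab.1 (ab.2 + 1) 2)⁻¹ * (A ab.1 ab.2 3)⁻¹ :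
              Matrix.unitaryGroup (Fin 3) ℂ) : Matrix (Fin 3) (Fin 3) ℂ).trace).re < δ₀),
            (3 - (((A ab.1 ab.2 2 * A (ab.1 + 1) ab.2 3 * (A ab.1 (ab.2 + 1) 2)⁻¹ * (A ab.1 ab.2 3)⁻¹ :
              Matrix.unitaryGroup (Fin 3) ℂ) : Matrix (Fin 3) (Fin 3) ℂ).trace).re) :=
    Finset.sum_nonneg fun ab _ => CellWalk.defi_nonneg _
  have hcast : (((2 * n + 1 : ℕ)) : ℝ) = 2 * n + 1 := by push_cast; ring
  rw [hcast] at hslack ⊢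
  have hn5 : (5 : ℝ) ≤ n := by exact_mod_cast (show 5 ≤ n by omega)
  have hr1 : (1 / 5 : ℝ) ≤ (n : ℝ) ^ 2 / (2 * n + 1) ^ 2 := by
    rw [div_le_div_iff₀ (by norm_num) (by positivity)]; nlinarith
  have hr2 : (n : ℝ) ^ 2 / (2 * n + 1) ^ 2 ≤ 1 := by
    rw [div_le_one (by positivity)]; nlinarith
  exact final_arith _ _ _ _ _ _ _ _ _ c₀ C₀ _ _ hmain hfree hslack hr1 hr2 hc₀ hS0 (Nat.cast_nonneg _)

/-- Coercion of the plaquette group product to matrices. -/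
theorem coe_plaq (a b c d : Matrix.unitaryGroup (Fin 3) ℂ) :
    ((a * b * c⁻¹ * d⁻¹ : Matrix.unitaryGroup (Fin 3) ℂ) : Matrix (Fin 3) (Fin 3) ℂ) =
      (a : Matrix (Fin 3) (Fin 3) ℂ) * (b : Matrix (Fin 3) (Fin 3) ℂ) * star (c : Matrix (Fin 3) (Fin 3) ℂ) *
        star (d : Matrix (Fin 3) (Fin 3) ℂ) := by
  have hc : ((c⁻¹ : Matrix.unitaryGroup (Fin 3) ℂ) : Matrix (Fin 3) (Fin 3) ℂ) = star (c : Matrix (Fin 3) (Fin 3) ℂ) := rfl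
  have hd : ((d⁻¹ : Matrix.unitaryGroup (Fin 3) ℂ) : Matrix (Fin 3) (Fin 3) ℂ) = star (d : Matrix (Fin 3) (Fin 3) ℂ) := rfl
  simp only [Submonoid.coe_mul, hc, hd]

/-- **S4 modulo the certificate** (registered form of `stub_heavyFrequencyGain`, given `CellKappaClaim`). -/
theorem heavyFrequencyGain_of_claim (hK : CellKappaClaim) : ∃ δ c C : ℝ, 0 < δ ∧ 0 < c ∧ ∃ L₀ : ℕ, ∀ (L : ℕ) [NeZero L], Odd L → L₀ ≤ L →
    ∀ (A : ZMod L → ZMod L → Fin 4 → Matrix.unitaryGroup (Fin 3) ℂ) (m : ℝ), |m| ≤ 1 / 10 → ∀ ω₀ ω₁ : ℝ,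
    Real.cos ω₀ ≤ -(199 / 200) → Real.cos ω₁ ≤ -(199 / 200) →
    let fD := fun (A : ZMod L → ZMod L → Fin 4 → Matrix.unitaryGroup (Fin 3) ℂ) (m ω₀ ω₁ : ℝ) =>
      Matrix.of fun (p q : (ZMod L × ZMod L) × Fin 3 × Fin 4) =>
        (if p.1 = q.1 ∧ p.2.1 = q.2.1 then
            (((m + 4 - Real.cos ω₀ - Real.cos ω₁ : ℝ) : ℂ) * (1 : Matrix (Fin 4) (Fin 4) ℂ) p.2.2 q.2.2 +
              Complex.I * (((Real.sin ω₀ : ℝ) : ℂ) * euclideanGamma 0 p.2.2 q.2.2 +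
                ((Real.sin ω₁ : ℝ) : ℂ) * euclideanGamma 1 p.2.2 q.2.2))
          else 0) -
          (1 / 2 : ℂ) *
            ((if q.1 = (p.1.1 + 1, p.1.2) then
                ((1 : Matrix (Fin 4) (Fin 4) ℂ) - euclideanGamma 2) p.2.2 q.2.2 *
                  ((if p.1.1 = -1 then (-1 : ℂ) else 1) * (A p.1.1 p.1.2 2 : Matrix (Fin 3) (Fin 3) ℂ) p.2.1 q.2.1)
              else 0) +
             (if p.1 = (q.1.1 + 1, q.1.2) then
                ((1 : Matrix (Fin 4) (Fin 4) ℂ) + euclideanGamma 2) p.2.2 q.2.2 *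
                  ((if q.1.1 = -1 then (-1 : ℂ) else 1) * (star (A q.1.1 q.1.2 2 : Matrix (Fin 3) (Fin 3) ℂ)) p.2.1 q.2.1)
              else 0) +
             (if q.1 = (p.1.1, p.1.2 + 1) then
                ((1 : Matrix (Fin 4) (Fin 4) ℂ) - euclideanGamma 3) p.2.2 q.2.2 *
                  ((if p.1.2 = -1 then (-1 : ℂ) else 1) * (A p.1.1 p.1.2 3 : Matrix (Fin 3) (Fin 3) ℂ) p.2.1 q.2.1)
              else 0) +
             (if p.1 = (q.1.1, q.1.2 + 1) then
                ((1 : Matrix (Fin 4) (Fin 4) ℂ) + euclideanGamma 3) p.2.2 q.2.2 *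
                  ((if q.1.2 = -1 then (-1 : ℂ) else 1) * (star (A q.1.1 q.1.2 3 : Matrix (Fin 3) (Fin 3) ℂ)) p.2.1 q.2.1)
              else 0));
    let dfc2 := fun (A : ZMod L → ZMod L → Fin 4 → Matrix.unitaryGroup (Fin 3) ℂ) (a b : ZMod L) =>
      3 - ((A a b 2 : Matrix (Fin 3) (Fin 3) ℂ) * (A (a + 1) b 3 : Matrix (Fin 3) (Fin 3) ℂ) *
        star (A a (b + 1) 2 : Matrix (Fin 3) (Fin 3) ℂ) * star (A a b 3 : Matrix (Fin 3) (Fin 3) ℂ)).trace.re;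
    ‖(fD A m ω₀ ω₁).det‖ ≤
      Real.exp (1 / (L : ℝ) ^ 2 - c * (∑ ab ∈ (Finset.univ : Finset (ZMod L × ZMod L)).filter (fun ab => dfc2 A ab.1 ab.2 < δ), dfc2 A ab.1 ab.2)
        + C * (((Finset.univ : Finset (ZMod L × ZMod L)).filter (fun ab => δ ≤ dfc2 A ab.1 ab.2)).card : ℝ)) *
      ‖(fD (fun _ _ _ => 1) m ω₀ ω₁).det‖ := by
  obtain ⟨δ, c, C, hδ, hc, _, core⟩ := heavyGain_core hK
  refine ⟨δ, c, C, hδ, hc, 25, ?_⟩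
  intro L _ hodd hL0 A m hm ω₀ ω₁ h0 h1 fD dfc2
  obtain ⟨n, rfl⟩ := hodd
  haveI : NeZero n := ⟨by omega⟩
  have hn : 12 ≤ n := by omega
  have hne1 : (freqOpR euclideanGamma (fun (_ _ : ZMod (2 * n + 1)) (_ : Fin 4) =>
      (1 : Matrix.unitaryGroup (Fin 3) ℂ)) m ω₀ ω₁).det ≠ 0 :=
    (heavyInvertible (2 * n + 1) (2 * n + 1) _ m hm ω₀ ω₁ h0 h1).ne_zero
  have key : ‖(freqOpR euclideanGamma A m ω₀ ω₁).det‖ ≤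
      Real.exp (1 / (((2 * n + 1 : ℕ)) : ℝ) ^ 2
        - c * (∑ ab ∈ (Finset.univ : Finset (ZMod (2 * n + 1) × ZMod (2 * n + 1))).filter
            (fun ab => dfc2 A ab.1 ab.2 < δ), dfc2 A ab.1 ab.2)
        + C * ((((Finset.univ : Finset (ZMod (2 * n + 1) × ZMod (2 * n + 1))).filter
            (fun ab => δ ≤ dfc2 A ab.1 ab.2)).card : ℕ) : ℝ)) *
      ‖(freqOpR euclideanGamma (fun (_ _ : ZMod (2 * n + 1)) (_ : Fin 4) => (1 : Matrix.unitaryGroup (Fin 3) ℂ)) m ω₀ ω₁).det‖ := by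
    have hpos1 : 0 < ‖(freqOpR euclideanGamma (fun (_ _ : ZMod (2 * n + 1)) (_ : Fin 4) =>
        (1 : Matrix.unitaryGroup (Fin 3) ℂ)) m ω₀ ω₁).det‖ := norm_pos_iff.mpr hne1
    by_cases hA : (freqOpR euclideanGamma A m ω₀ ω₁).det = 0
    · rw [hA, norm_zero]; positivity
    obtain ⟨_, hlog⟩ := core n hn A m hm ω₀ ω₁ h0 h1 hA
    simp only [coe_plaq] at hlog
    have hposA : 0 < ‖(freqOpR euclideanGamma A m ω₀ ω₁).det‖ := norm_pos_iff.mpr hA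
    rw [← Real.exp_log hposA, ← Real.exp_log hpos1, ← Real.exp_add]
    exact Real.exp_le_exp.mpr (by linarith [hlog])
  exact key


end HeavyGain

/-- **S4 `stub_heavyFrequencyGain`** — at the HEAVY frequencies (`cos ω₀, cos ω₁ ≤ −199/200`, i.e. `|ω_i − π| ≲ 1/10`, effective mass `≥ m + 5.99`)
the 2D frequency determinant GAINS from every good plaquette and pays at most `C` per bad one, up to a `1/L²` slack for
walks winding around the torus: non-backtracking walk expansion of `log det(N_ω − H_A)` (immediate reversals vanish for
`r = 1`: `P₋^μ V P₊^μ Vᴴ = 0`; turn factor `‖P^νP^μ‖ = 2^(-1/2)`; absolutely convergent for `ρ_ω > 1 + √2`), exact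
plaquette (`n = 4`) and rectangle (`n = 6`) terms, homotopy (non-abelian Stokes) bound `3 − Re tr hol(ℓ) ≤ |A(ℓ)| Σ_p |w_ℓ(p)| dfc_p`
for the rest, tail from `n = 8`. [difficulty: XL] -/
theorem stub_heavyFrequencyGain : ∃ δ c C : ℝ, 0 < δ ∧ 0 < c ∧ ∃ L₀ : ℕ, ∀ (L : ℕ) [NeZero L], Odd L → L₀ ≤ L →
    ∀ (A : ZMod L → ZMod L → Fin 4 → Matrix.unitaryGroup (Fin 3) ℂ) (m : ℝ), |m| ≤ 1 / 10 → ∀ ω₀ ω₁ : ℝ,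
    Real.cos ω₀ ≤ -(199 / 200) → Real.cos ω₁ ≤ -(199 / 200) →
    let fD := fun (A : ZMod L → ZMod L → Fin 4 → Matrix.unitaryGroup (Fin 3) ℂ) (m ω₀ ω₁ : ℝ) =>
      Matrix.of fun (p q : (ZMod L × ZMod L) × Fin 3 × Fin 4) =>
        (if p.1 = q.1 ∧ p.2.1 = q.2.1 then
            (((m + 4 - Real.cos ω₀ - Real.cos ω₁ : ℝ) : ℂ) * (1 : Matrix (Fin 4) (Fin 4) ℂ) p.2.2 q.2.2 +
              Complex.I * (((Real.sin ω₀ : ℝ) : ℂ) * euclideanGamma 0 p.2.2 q.2.2 +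
                ((Real.sin ω₁ : ℝ) : ℂ) * euclideanGamma 1 p.2.2 q.2.2))
          else 0) -
          (1 / 2 : ℂ) *
            ((if q.1 = (p.1.1 + 1, p.1.2) then
                ((1 : Matrix (Fin 4) (Fin 4) ℂ) - euclideanGamma 2) p.2.2 q.2.2 *
                  ((if p.1.1 = -1 then (-1 : ℂ) else 1) * (A p.1.1 p.1.2 2 : Matrix (Fin 3) (Fin 3) ℂ) p.2.1 q.2.1)
              else 0) +
             (if p.1 = (q.1.1 + 1, q.1.2) then
                ((1 : Matrix (Fin 4) (Fin 4) ℂ) + euclideanGamma 2) p.2.2 q.2.2 *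
                  ((if q.1.1 = -1 then (-1 : ℂ) else 1) * (star (A q.1.1 q.1.2 2 : Matrix (Fin 3) (Fin 3) ℂ)) p.2.1 q.2.1)
              else 0) +
             (if q.1 = (p.1.1, p.1.2 + 1) then
                ((1 : Matrix (Fin 4) (Fin 4) ℂ) - euclideanGamma 3) p.2.2 q.2.2 *
                  ((if p.1.2 = -1 then (-1 : ℂ) else 1) * (A p.1.1 p.1.2 3 : Matrix (Fin 3) (Fin 3) ℂ) p.2.1 q.2.1)
              else 0) +
             (if p.1 = (q.1.1, q.1.2 + 1) then
                ((1 : Matrix (Fin 4) (Fin 4) ℂ) + euclideanGamma 3) p.2.2 q.2.2 *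
                  ((if q.1.2 = -1 then (-1 : ℂ) else 1) * (star (A q.1.1 q.1.2 3 : Matrix (Fin 3) (Fin 3) ℂ)) p.2.1 q.2.1)
              else 0));
    let dfc2 := fun (A : ZMod L → ZMod L → Fin 4 → Matrix.unitaryGroup (Fin 3) ℂ) (a b : ZMod L) =>
      3 - ((A a b 2 : Matrix (Fin 3) (Fin 3) ℂ) * (A (a + 1) b 3 : Matrix (Fin 3) (Fin 3) ℂ) *
        star (A a (b + 1) 2 : Matrix (Fin 3) (Fin 3) ℂ) * star (A a b 3 : Matrix (Fin 3) (Fin 3) ℂ)).trace.re;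
    ‖(fD A m ω₀ ω₁).det‖ ≤
      Real.exp (1 / (L : ℝ) ^ 2 - c * (∑ ab ∈ (Finset.univ : Finset (ZMod L × ZMod L)).filter (fun ab => dfc2 A ab.1 ab.2 < δ), dfc2 A ab.1 ab.2)
        + C * (((Finset.univ : Finset (ZMod L × ZMod L)).filter (fun ab => δ ≤ dfc2 A ab.1 ab.2)).card : ℝ)) *
      ‖(fD (fun _ _ _ => 1) m ω₀ ω₁).det‖ :=
  HeavyGain.heavyFrequencyGain_of_claim CellKappa.cellKappaClaim_holds

end Summit.QuantumFields.QCD.Cruxes.CriticalLineDiamagnetism.ChessboardCellGain
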